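import Summits.QuantumFields.BalabanUV.Beta.GAN24.DressedSourceZeroModeLevelZero
import Summits.QuantumFields.BalabanUV.Beta.GAN24.VHWordsZeroBorder
import Summits.QuantumFields.BalabanUV.Beta.SpineRecursiveW
import Summits.QuantumFields.BalabanUV.Beta.SpineRecursivePureParity
import Summits.QuantumFields.BalabanUV.Beta.SpineRecursiveParity

/-!
# `BalabanUV.Beta.GAN24.ForcingTableRootLetters` — binder row G-an2-4 ∕ (CONV-C), W-slot (α-0), ROW (C) AT LEVELS `≥ 1` (the OWNER's two-index tower, RULING
# R-gan24p1-g40-1; typer's PART VI rows T6-STEP ∕ T6-VAL): **ROAD-P2's ROOT LETTERS FOR THE THREE FIRST TABLES OF THE E-FRAME FORCING THROUGH THE UNITS, AT EVERY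
# LEVEL** — the side conditions that leaf-02's Part 50c `ForcingFacePairFormAssembly.forcingPairForm_dressedStep` (shape) and leaf-06 g57's
# `FaceReadCrossedValueZero.crossed_faceRead_dressedStep_zero` (value) leave as hypotheses (`hS ∕ hSt ∕ hSrow`, `hM ∕ hMt ∕ hMrow`, `hM₂ ∕ hM₂t`), discharged once for road-P2's
# ACTUAL tower letters `S̃_j = unitS sf sm (SpureRecAt d Lc ρ_c cE cVH cΛ j)`, `M̃_j = unitM sf sm (M1At d Lc ρ_c cΛ j)`, `M̃₂_j = unitM₂ sf sm (M2Of d Lc (mixFFAt ρ_c Lc) j)`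
# (in-block root `ρ_c = toSite r`, `r ∈ box`; generic `d`, any `sf sm`, every `j`)
# (road-P2 chair `b2b-balaban-gan24-p2`, gen 51; journal [GAN24P2-G51-INTENT3])

NOT IN PRINT; OUR BOOKKEEPING ([folklore] unit transports BY NAME of an2's `SpineRooted.locStencil_SpureRecAt ∕ SpureRecAt_translate ∕ vertexFamily_M1At ∕ M1At_translate`,
`SpineRecursivePureParity.trK_SpureRecAt`, `SpineRecursiveParity.trK_M1At`, an1's `MixedJetTablesPlug.hmix_an1 ∕ hmixt_an1` with `BalabanStepW2.locStencilFM_M2Of ∕ M2Of_translate`,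
through `HessKerDressedUnits.locStencil_unitS ∕ biLoc_counitK`, `VHWordsZeroBorder.unitS_translate_block`, leaf-04's `DressedSourceZeroModeLevelZero.locStencilFM_unitM₂` (its level-`0`
transports, every `j`); the two parity transports are leaf-02 g69 Part 48 §1's `trK_unitS_of_rows ∕ trK_unitM_of_rows` specialised (same four-line proof, stated for the root tables so
that this file imports built modules only); 0 `def`, 0 cited fact, 0 `def … : Prop`, 0 sorry).  HONEST FRAMING (cell contract, verbatim): «discharging `BetaPertH` makes Bałaban's UV
stability UNCONDITIONAL — a real constructive-QFT result; it is NOT the continuum limit and NOT the Clay problem.»  HONEST DEPENDENCY (verbatim): «continuum YM on T⁴ ⇐ BetaPertH ∧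
nine spine estimates (0/9 proved); BetaPertH ⇐ (D1) ∧ (D4) ∧ CAP+tail; G-an2-4 gates asym, D1 and NE2/3/4.»

WHAT (every `j`, generic `d`, any `sf sm`): `exists_locStencil_unitS_SpureRecAt` ∕ `unitS_SpureRecAt_translate` ∕ `trK_unitS_SpureRecAt` (the field table `S̃_j`: local stencil,
`Lc`-block covariant, parity-odd rows); `vertexFamily_unitM_M1At` ∕ `unitM_M1At_translate` ∕ `trK_unitM_M1At` (the multiplier table `M̃_j`: vertex family at scale `Lc` with rate `1`,
translation law, parity-odd rows); `exists_locStencilFM_unitM₂_M2Of` ∕ `unitM₂_M2Of_translate` (the mixed table `M̃₂_j`: `LocStencilFM`, joint translation law).  CONSUMERS: road-P2's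
`CombChargeTowerForcingAdapter` (`hBF` of `CombChargeTowerClosure` from Part 50c ∕ 51) and `FaceReadCrossedValueRoot` (leaf-03's `hface0` left side from leaf-06 g57's (Q) ∕ (R)).
Asserts NO value of Bałaban's tables; discharges NOTHING of (C)_{≥1} ∕ `hB0` ∕ `hBF` ∕ `hX` ∕ `hXu` ∕ (Q-L) ∕ (H1♮) ∕ (hW, hWall); NEVER «G-an2-4 closed» as (CONV-C); NOT D1, NOT
`BetaPertH`, NOT continuum, NOT Clay.  2026-08-24; no existing file touched.
-/

noncomputable section

open Finset
open scoped BigOperators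
open Literature.MathematicalPhysics.QuantumFieldTheory
open Literature.MathematicalPhysics.QuantumFieldTheory.Balaban1983to89
open Literature.MathematicalPhysics.QuantumFieldTheory.Balaban1983to89.Beta
open ExpKernelCalculus (Site MKer shiftK VertexFamily)
open OneStepResolventKernel (Fib LocStencil)
open SecondOrderResponse (LocStencilFM biLoc_smul)
open BalabanStepW2 (M2Of locStencilFM_M2Of M2Of_translate)
open AffineAveraging (box toSite)
open AveragingMixedJetTables (mixFFAt)
open Summit.QuantumFields.BalabanUV.Beta.TameKernelCalculus (trK trK_apply)
open Summit.QuantumFields.BalabanUV.Beta.BorderedHessian (sgnK sgnK_apply)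
open Summit.QuantumFields.BalabanUV.Beta.HessKerDressedUnits (unitS unitS_apply counitK counitK_apply locStencil_unitS biLoc_counitK)
open Summit.QuantumFields.BalabanUV.Beta.SecondOrderUnits (unitM unitM₂ unitM_apply)
open Summit.QuantumFields.BalabanUV.Beta.SpineRooted (SpureRecAt M1At locStencil_SpureRecAt SpureRecAt_translate vertexFamily_M1At M1At_translate)
open Summit.QuantumFields.BalabanUV.Beta.SpineRecursivePureParity (trK_SpureRecAt)
open Summit.QuantumFields.BalabanUV.Beta.SpineRecursiveParity (trK_M1At)
open Summit.QuantumFields.BalabanUV.Beta.MixedJetTablesPlug (hmix_an1 hmixt_an1)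
open Summit.QuantumFields.BalabanUV.Beta.GAN24.VHWordsZeroBorder (unitS_translate_block)
open Summit.QuantumFields.BalabanUV.Beta.GAN24.DressedSourceZeroModeLevelZero (locStencilFM_unitM₂)

namespace Summit.QuantumFields.BalabanUV.Beta.GAN24.ForcingTableRootLetters

variable {d : ℕ} {Lc : ℕ} [NeZero Lc] {r : Fin (d + 1) → ℕ}

/-! ## The field table `S̃_j = unitS sf sm (SpureRecAt d Lc ρ_c cE cVH cΛ j)` -/

/-- [folklore] `S̃_j` is a local stencil (an2's `locStencil_SpureRecAt` through `locStencil_unitS`). -/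
theorem exists_locStencil_unitS_SpureRecAt (hLc : 1 ≤ Lc) (hr : r ∈ box (d + 1) Lc) (sf sm cE cVH cΛ : ℝ) (j : ℕ) :
    ∃ Cs δs : ℝ, 0 < δs ∧ LocStencil (unitS sf sm (SpureRecAt d Lc (toSite r) cE cVH cΛ j)) Cs δs := by
  obtain ⟨Cs, δ, hδ, hS⟩ := locStencil_SpureRecAt hLc hr cE cVH cΛ j
  exact ⟨_, δ, hδ, locStencil_unitS hS⟩

/-- [folklore] `S̃_j` is `Lc`-block covariant (an2's `SpureRecAt_translate` through `unitS_translate_block`). -/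
theorem unitS_SpureRecAt_translate (hLc : 1 ≤ Lc) (sf sm cE cVH cΛ : ℝ) (j : ℕ) (κ : Fin (d + 1)) (u t : Site (d + 1)) :
    unitS sf sm (SpureRecAt d Lc (toSite r) cE cVH cΛ j) κ (u + (Lc : ℤ) • t)
      = shiftK (-((Lc : ℤ) • t)) (unitS sf sm (SpureRecAt d Lc (toSite r) cE cVH cΛ j) κ u) :=
  unitS_translate_block (Lc := Lc) sf sm (fun κ u t => SpureRecAt_translate (toSite r) hLc cE cVH cΛ j κ u t) κ u t

/-- [folklore] `S̃_j` has parity-odd rows (an2's `trK_SpureRecAt`; the unit rescaling commutes with `trK` and `sgnK` — leaf-02 g69 Part 48 §1's four lines). -/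
theorem trK_unitS_SpureRecAt (hLc : 1 ≤ Lc) (hr : r ∈ box (d + 1) Lc) (sf sm cE cVH cΛ : ℝ) (j : ℕ) (κ : Fin (d + 1)) (u : Site (d + 1)) :
    trK (unitS sf sm (SpureRecAt d Lc (toSite r) cE cVH cΛ j) κ u) = -sgnK (unitS sf sm (SpureRecAt d Lc (toSite r) cE cVH cΛ j) κ u) := by
  funext x z a b
  have h := congrFun (congrFun (congrFun (congrFun (trK_SpureRecAt hLc hr cE cVH cΛ j κ u) x) z) a) b
  simp only [trK_apply, Pi.neg_apply, sgnK_apply] at h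
  simp only [trK_apply, Pi.neg_apply, sgnK_apply, unitS_apply]
  rw [h]
  ring

/-! ## The multiplier table `M̃_j = unitM sf sm (M1At d Lc ρ_c cΛ j)` -/

omit [NeZero Lc] in
/-- [folklore] `M̃_j` is a vertex family at scale `Lc`, rate `1` (an2's `vertexFamily_M1At` through `biLoc_counitK` ∕ `biLoc_smul`; leaf-04's level-`0` transport, every `j`). -/
theorem vertexFamily_unitM_M1At (hLc : 1 ≤ Lc) (hr : r ∈ box (d + 1) Lc) (sf sm cΛ : ℝ) (j : ℕ) :
    VertexFamily (unitM sf sm (M1At d Lc (toSite r) cΛ j)) Lc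
      (|(sm * sm)⁻¹| * (max |sf⁻¹| |sm⁻¹| * (|cΛ * BalabanStepW2.wM1 d Lc j| * (2 * (AveragingHessianKernels.ell (d + 1) Lc : ℝ) ^ 2 * Real.exp (4 * ((d : ℝ) + 1) * Lc * 1))) *
        max |sf⁻¹| |sm⁻¹|)) 1 :=
  fun ρ' w => biLoc_smul ((sm * sm)⁻¹) (biLoc_counitK (vertexFamily_M1At hLc hr cΛ j zero_le_one ρ' w))

omit [NeZero Lc] in
/-- [folklore] `M̃_j` as an `∃`-packaged vertex family with a positive rate (the shape leaf-02 ∕ leaf-06 consume). -/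
theorem exists_vertexFamily_unitM_M1At (hLc : 1 ≤ Lc) (hr : r ∈ box (d + 1) Lc) (sf sm cΛ : ℝ) (j : ℕ) :
    ∃ CM δM : ℝ, 0 < δM ∧ VertexFamily (unitM sf sm (M1At d Lc (toSite r) cΛ j)) Lc CM δM :=
  ⟨_, 1, one_pos, vertexFamily_unitM_M1At hLc hr sf sm cΛ j⟩

omit [NeZero Lc] in
/-- [folklore] `M̃_j`'s translation law (an2's `M1At_translate` through `unitM`). -/
theorem unitM_M1At_translate (sf sm cΛ : ℝ) (j : ℕ) (ρ' : Fin (d + 1)) (w t : Site (d + 1)) :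
    unitM sf sm (M1At d Lc (toSite r) cΛ j) ρ' (w + t) = shiftK (-((Lc : ℤ) • t)) (unitM sf sm (M1At d Lc (toSite r) cΛ j) ρ' w) := by
  funext x z a b
  simp only [unitM_apply, shiftK, M1At_translate (Lc := Lc) (toSite r) cΛ j ρ' w t]

/-- [folklore] `M̃_j` has parity-odd rows (an1's `trK_M1At`; the unit rescaling commutes with `trK` and `sgnK`). -/
theorem trK_unitM_M1At (sf sm cΛ : ℝ) (j : ℕ) (ρ' : Fin (d + 1)) (w : Site (d + 1)) :
    trK (unitM sf sm (M1At d Lc (toSite r) cΛ j) ρ' w) = -sgnK (unitM sf sm (M1At d Lc (toSite r) cΛ j) ρ' w) := by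
  funext x z a b
  have h := congrFun (congrFun (congrFun (congrFun (trK_M1At (Lc := Lc) (toSite r) cΛ j ρ' w) x) z) a) b
  simp only [trK_apply, Pi.neg_apply, sgnK_apply] at h
  simp only [trK_apply, Pi.neg_apply, sgnK_apply, unitM_apply]
  rw [h]
  ring

/-! ## The mixed table `M̃₂_j = unitM₂ sf sm (M2Of d Lc (mixFFAt ρ_c Lc) j)` -/

omit [NeZero Lc] in
/-- [folklore] `M̃₂_j` is a `LocStencilFM` (an1's `hmix_an1` through `locStencilFM_M2Of` and leaf-04's `locStencilFM_unitM₂`). -/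
theorem exists_locStencilFM_unitM₂_M2Of (hLc : 1 ≤ Lc) (hr : r ∈ box (d + 1) Lc) (sf sm : ℝ) (j : ℕ) :
    ∃ C₂ δ₂ : ℝ, 0 < δ₂ ∧ LocStencilFM Lc (unitM₂ sf sm (M2Of d Lc (mixFFAt (toSite r) Lc) j)) C₂ δ₂ := by
  obtain ⟨C₂, δ₂, hδ₂, hmix⟩ := hmix_an1 hLc hr
  exact ⟨_, δ₂, hδ₂, locStencilFM_unitM₂ (Lc := Lc) (M₂ := M2Of d Lc (mixFFAt (toSite r) Lc) j) sf sm (locStencilFM_M2Of hmix j)⟩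

omit [NeZero Lc] in
/-- [folklore] `M̃₂_j`'s joint translation law (an1's `hmixt_an1` through `M2Of_translate` and the units). -/
theorem unitM₂_M2Of_translate (sf sm : ℝ) (j : ℕ) (κ : Fin (d + 1)) (u : Site (d + 1)) (ρ' : Fin (d + 1)) (w t : Site (d + 1)) :
    unitM₂ sf sm (M2Of d Lc (mixFFAt (toSite r) Lc) j) κ (u + (Lc : ℤ) • t) ρ' (w + t)
      = shiftK (-((Lc : ℤ) • t)) (unitM₂ sf sm (M2Of d Lc (mixFFAt (toSite r) Lc) j) κ u ρ' w) := by
  funext x z a b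
  simp only [unitM₂, unitM, Pi.smul_apply, smul_eq_mul, counitK_apply, shiftK, M2Of_translate (hmixt_an1 (toSite r)) j κ u ρ' w t]

end Summit.QuantumFields.BalabanUV.Beta.GAN24.ForcingTableRootLetters

end
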